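import Summits.QuantumFields.YangMills.Theorems.BalabanUVNodesN18KernelStepRateKingMechanism
import Summits.QuantumFields.YangMills.Theorems.BalabanUVNodesN18AtRecordOfKernelLetters
import Summits.QuantumFields.YangMills.Theorems.BalabanUVNodesN27ReadOutAtU3OfKernels

/-!
# BalabanUVNodes ∕ N18 — KING's MECHANISM AT THE KERNEL OBJECTS OF RECORD, FILE 2: the record editions `KernelStepRateOfRecord₁₃` ∕ `KernelDecayOfRecord₁₃` from the
# three-factor mechanism on the record's window `Window θ.γ`, and — under the K3⁷ v5 reading pin `U3PinnedKernels` — the N18 conjunct at every run length and the (D4) read-out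
# (Track A, DAG node N18 = NE5; key K3⁷ `SpineGivenEndpointR13SepCoPH` stmt-QuantumFields-20544, skeleton v5 941dddb108cbaacf; width seat `pub-ymgap-dag-n18-w4` g0; FILE 2 of 2
# after `…N18KernelStepRateKingMechanism`; the FINITE-VOLUME editions — the windowed rows `hS` ∕ `hW` of n27-w1's v5 bill — are FILE 3 `…N18KernelStepRateKingMechanismWindowed`)

HONEST FRAMING.  Count-neutral kernel bookkeeping BY NAME (`--kind proof --supports stmt-QuantumFields-20544 --as helper`).  HYPOTHESIS-FORM: the three-factor structure, sizes,
one-line rates and lattice sums of the limiting (1.21) kernels of the MERGED TERM OF RECORD are HYPOTHESES (King's printed model of the mechanism, [King1986] p. 665 ∕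
(4.42)–(4.43) p. 675, read at the objects of record); NE5 for Bałaban's outputs is NOT PRINTED for d = 4 and NOT proved; (5.10) for the (1.21) kernels is NOT discharged.
Nothing of Bałaban is asserted; N18 NOT discharged; (D4) NOT discharged; K3⁷ OPEN, not claimed; counts UNMOVED (typed 28∕28 · discharged 5∕27, A 5∕28).  Finite 𝕋⁴ at fixed `ε`;
R4 closes the conditional rung `BalabanLadder.UV` only — NOT ℝ⁴ ∕ infinite volume ∕ OS ∕ mass gap ∕ Clay.  THEOREMS ONLY: 0 `def`, 0 `sorry`, standard axioms.

WHAT (hypotheses stated on def-W1's record faces: run A's level functional of record `(objectsOfRecord₁₃ F N θ ℓ).EA k g · (pt k μ ν z)` = the limiting kernel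
`Π_{k+1,μν}(g; z)` of the merged term of record in the record's β-chart, run B's family `(…).EB k b g · (pt k μ ν z)` = `Π_{k+2,μν}(b, g; z)`).
* `kernelStepRateOfRecord₁₃_of_threeFactorRates` — FILE 1's `kernelStepRate_of_threeFactorRates` at the record: `KernelStepRateOfRecord₁₃ F N θ (κ∕2) θ₅ ((cA·sC·sB + sA·cC·sB +
  sA·sC·cB)·V²)`; `kernelDecayOfRecord₁₃_of_threeFactorSizes` — run A's SIZES ⟹ `KernelDecayOfRecord₁₃ F N θ μ ν (κ∕2)`; `kernelStepRateOfRecord₁₃_mono`, `kernelDecayOfRecord₁₃_anti`.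
* ★★★ `n18At_rateCarriers_of_kernels_pin_of_threeFactorRates` — under `hpin : (𝔯.lit F θ hP g₀ os).u3 = objectsOfRecord₁₃ F N θ ℓ` (K3⁷ v5 `U3PinnedKernels 𝔯 ℓ'` at the tuple,
  `ℓ := ℓ' F θ`) and a letter block DOMINATING the mechanism's letters (`ℓ.κ ≤ κ∕2`, `θ₅ ≤ ℓ.θ₅`, `(…)·V² ≤ ℓ.C₅`), the N18 conjunct `N18At (rateCarriersOfRecord₁₃CoPH 𝔯 F θ hP g₀ os
  k).u3` at EVERY run length `k` — the N18 conjunct of `KeyedRatesHolderD4` at the selected level (dag-n18-w1 `n18At_rateCarriers_of_kernels_pin_of_kernelStepRateOfRecord₁₃`).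
* ★★ `readOutAt_rateCarriers_of_kernels_pin_of_threeFactorSizes` — run A's SIZES + the letter rows `ℓ.Signs`, `0 < ℓ.κ ≤ κ∕2`, `betaPrime510 4 1 ℓ.κ ≤ ℓ.cr` ⟹ the (D4)
  conjunct `ReadOutAt (datumOfRecord₁₃CoPH F N θ hP) (…).u3` at every run length (dag-n27-w1 `readOutAt_objectsOfRecord₁₃_coPH`).  ONE set of King-mechanism hypotheses on the
  kernels of record thus serves N18 AND (D4)'s decay input under the pin; NEITHER is discharged — the hypotheses ARE the estimates.

Sources (TYPES and the mechanism only): C. King, Commun. Math. Phys. **102** (1986) 649–677 [King1986] — Prop. 3.9 (3.73) p. 665, (4.41)–(4.43) p. 675; T. Bałaban,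
Commun. Math. Phys. **109** (1987) 249–301 [Balaban1987RG1] — Thm 1 p. 259, (1.6) p. 261, (1.20)–(1.22) p. 264, (5.10) p. 293.  No claim about the mass gap.
-/

noncomputable section

namespace YMDAG.N18.KernelStepRateKingMechanism

open scoped BigOperators
open Matrix
open Literature.MathematicalPhysics.QuantumFieldTheory.Balaban1983to89
open Literature.MathematicalPhysics.QuantumFieldTheory.Balaban1983to89.T4Continuum (T4Family ULoop)
open Literature.MathematicalPhysics.QuantumFieldTheory.Balaban1983to89.T4OutputRate (Window)
open Literature.MathematicalPhysics.QuantumFieldTheory.Balaban1983to89.B12Sec2to5 (l1 betaPrime510)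
open Node00 (U3Letters₁₁ Stage13Params Stage13HParams datumOfRecord₁₃CoPH)
open Node00.U3OfKernels (pt bg objectsOfRecord₁₃ KernelDecayOfRecord₁₃)
open Node00.U3KernelLetters (KernelStepRateOfRecord₁₃)
open Summit.QuantumFields.YangMills.BalabanUVNodes.N27ReadOutAtU3OfKernels (readOutAt_objectsOfRecord₁₃_coPH)
open YMDAG.N18.AtRecordOfKernelLetters (n18At_rateCarriers_of_kernels_pin_of_kernelStepRateOfRecord₁₃)
open YMDAG.UVSplit

/-! ## §4 At the record (Stage 13) and under the K3⁷ v5 reading pin `U3PinnedKernels` -/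

section Record

open scoped Matrix.Norms.L2Operator

variable (F : T4Family) (N : ℕ) [NeZero N]
variable {β : ℕ → Type*} [∀ k, Fintype (β k)] {P : ℕ → Type*}

/-- **THE N18 LETTER OF RECORD FROM THE MECHANISM AT THE OBJECTS OF RECORD.**  Hypotheses as in `kernelStepRate_of_threeFactorRates`, stated on def-W1's record faces: run
A's level functional of record `(objectsOfRecord₁₃ F N θ ℓ).EA k g · (pt k μ ν z)` (= the limiting kernel `Π_{k+1,μν}(g; z)` of the merged term of record in the
record's β-chart) and run B's family `(…).EB k b g · (pt k μ ν z)` (= `Π_{k+2,μν}(b, g; z)`), on the record's window `]0, θ.γ]^ℕ` ⟹ `KernelStepRateOfRecord₁₃ F N θ (κ∕2) θ₅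
((cA·sC·sB + sA·cC·sB + sA·sC·cB)·V²)`. [cite: King1986, (4.42)–(4.43) p.675; Balaban1987RG1, Thm 1 p.259, (1.6) p.261 and (1.20)–(1.22) p.264] -/
theorem kernelStepRateOfRecord₁₃_of_threeFactorRates (θ : Stage13Params F N) (ℓ : U3Letters₁₁)
    (ρd : (k : ℕ) → P k → P k → ℝ) (hρ0 : ∀ k p q, 0 ≤ ρd k p q) (hρtri : ∀ k p q r, ρd k p r ≤ ρd k p q + ρd k q r)
    (q : (k : ℕ) → β k → P k) (p r : (k : ℕ) → Fin 4 → Fin 4 → (Fin 4 → ℤ) → P k)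
    (uA vA : (ℕ → ℝ) → (k : ℕ) → Fin 4 → Fin 4 → (Fin 4 → ℤ) → β k → ℝ)
    (CA : (ℕ → ℝ) → (k : ℕ) → Fin 4 → Fin 4 → (Fin 4 → ℤ) → Matrix (β k) (β k) ℝ)
    (uB vB : ℝ → (ℕ → ℝ) → (k : ℕ) → Fin 4 → Fin 4 → (Fin 4 → ℤ) → β k → ℝ)
    (CB : ℝ → (ℕ → ℝ) → (k : ℕ) → Fin 4 → Fin 4 → (Fin 4 → ℤ) → Matrix (β k) (β k) ℝ)
    {κ θ₅ sA sC sB cA cC cB V : ℝ} (hκ : 0 ≤ κ) (hθ : 0 ≤ θ₅) (hsA : 0 ≤ sA) (hsC : 0 ≤ sC) (hsB : 0 ≤ sB)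
    (hcA : 0 ≤ cA) (hcC : 0 ≤ cC) (hcB : 0 ≤ cB)
    (hEA : ∀ g ∈ Window θ.γ, ∀ (k : ℕ) (μ ν : Fin 4) (z : Fin 4 → ℤ),
      (objectsOfRecord₁₃ F N θ ℓ).EA k g PUnit.unit (pt k μ ν z) = uA g k μ ν z ⬝ᵥ (CA g k μ ν z *ᵥ vA g k μ ν z))
    (hEB : ∀ b : ℝ, 0 < b → b ≤ θ.γ → ∀ g ∈ Window θ.γ, ∀ (k : ℕ) (μ ν : Fin 4) (z : Fin 4 → ℤ),
      (objectsOfRecord₁₃ F N θ ℓ).EB k b g (bg k μ ν z) (pt k μ ν z) = uB b g k μ ν z ⬝ᵥ (CB b g k μ ν z *ᵥ vB b g k μ ν z))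
    (hu : ∀ g ∈ Window θ.γ, ∀ (k : ℕ) (μ ν : Fin 4) (z : Fin 4 → ℤ) (i : β k),
      |uA g k μ ν z i| ≤ sA * Real.exp (-(κ * ρd k (p k μ ν z) (q k i))))
    (hCA : ∀ g ∈ Window θ.γ, ∀ (k : ℕ) (μ ν : Fin 4) (z : Fin 4 → ℤ) (i i' : β k),
      |CA g k μ ν z i i'| ≤ sC * Real.exp (-(κ * ρd k (q k i) (q k i'))))
    (hCB : ∀ b : ℝ, 0 < b → b ≤ θ.γ → ∀ g ∈ Window θ.γ, ∀ (k : ℕ) (μ ν : Fin 4) (z : Fin 4 → ℤ) (i i' : β k),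
      |CB b g k μ ν z i i'| ≤ sC * Real.exp (-(κ * ρd k (q k i) (q k i'))))
    (hv : ∀ b : ℝ, 0 < b → b ≤ θ.γ → ∀ g ∈ Window θ.γ, ∀ (k : ℕ) (μ ν : Fin 4) (z : Fin 4 → ℤ) (i' : β k),
      |vB b g k μ ν z i'| ≤ sB * Real.exp (-(κ * ρd k (q k i') (r k μ ν z))))
    (hdu : ∀ b : ℝ, 0 < b → b ≤ θ.γ → ∀ g ∈ Window θ.γ, ∀ (k : ℕ) (μ ν : Fin 4) (z : Fin 4 → ℤ) (i : β k),
      |uB b g k μ ν z i - uA g k μ ν z i| ≤ cA * θ₅ ^ (k + 1) * Real.exp (-(κ * ρd k (p k μ ν z) (q k i))))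
    (hdC : ∀ b : ℝ, 0 < b → b ≤ θ.γ → ∀ g ∈ Window θ.γ, ∀ (k : ℕ) (μ ν : Fin 4) (z : Fin 4 → ℤ) (i i' : β k),
      |CB b g k μ ν z i i' - CA g k μ ν z i i'| ≤ cC * θ₅ ^ (k + 1) * Real.exp (-(κ * ρd k (q k i) (q k i'))))
    (hdv : ∀ b : ℝ, 0 < b → b ≤ θ.γ → ∀ g ∈ Window θ.γ, ∀ (k : ℕ) (μ ν : Fin 4) (z : Fin 4 → ℤ) (i' : β k),
      |vB b g k μ ν z i' - vA g k μ ν z i'| ≤ cB * θ₅ ^ (k + 1) * Real.exp (-(κ * ρd k (q k i') (r k μ ν z))))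
    (hV : ∀ (k : ℕ) (s : P k), ∑ i, Real.exp (-(κ / 2 * ρd k s (q k i))) ≤ V)
    (hd : ∀ (k : ℕ) (μ ν : Fin 4) (z : Fin 4 → ℤ), l1 z ≤ ρd k (p k μ ν z) (r k μ ν z)) :
    KernelStepRateOfRecord₁₃ F N θ (κ / 2) θ₅ ((cA * sC * sB + sA * cC * sB + sA * sC * cB) * V ^ 2) := by
  letI := θ.instVβ₁; letI := θ.instVβ₂; letI := θ.instιβ
  exact kernelStepRate_of_threeFactorRates F _ θ.ρ8 θ.bV ρd hρ0 hρtri q p r uA vA CA uB vB CB hκ hθ hsA hsC hsB hcA hcC hcB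
    hEA hEB hu hCA hCB hv hdu hdC hdv hV hd

/-- **THE (5.10) CLASS LETTER OF RECORD FROM RUN A's SIZES AT THE OBJECTS OF RECORD**: `KernelDecayOfRecord₁₃ F N θ μ ν (κ∕2)` at every direction pair — the `hdec` of
dag-n27-w1's `readOutAt_objectsOfRecord₁₃_coPH`. [cite: Balaban1987RG1, (5.10) p.293 and (1.20)–(1.22) p.264; King1986, (4.41) p.675] -/
theorem kernelDecayOfRecord₁₃_of_threeFactorSizes (θ : Stage13Params F N) (ℓ : U3Letters₁₁)
    (ρd : (k : ℕ) → P k → P k → ℝ) (hρ0 : ∀ k p q, 0 ≤ ρd k p q) (hρtri : ∀ k p q r, ρd k p r ≤ ρd k p q + ρd k q r)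
    (q : (k : ℕ) → β k → P k) (p r : (k : ℕ) → Fin 4 → Fin 4 → (Fin 4 → ℤ) → P k)
    (uA vA : (ℕ → ℝ) → (k : ℕ) → Fin 4 → Fin 4 → (Fin 4 → ℤ) → β k → ℝ)
    (CA : (ℕ → ℝ) → (k : ℕ) → Fin 4 → Fin 4 → (Fin 4 → ℤ) → Matrix (β k) (β k) ℝ)
    {κ sA sC sB V : ℝ} (hκ : 0 ≤ κ) (hsA : 0 ≤ sA) (hsC : 0 ≤ sC) (hsB : 0 ≤ sB)
    (hEA : ∀ g ∈ Window θ.γ, ∀ (k : ℕ) (μ ν : Fin 4) (z : Fin 4 → ℤ),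
      (objectsOfRecord₁₃ F N θ ℓ).EA k g PUnit.unit (pt k μ ν z) = uA g k μ ν z ⬝ᵥ (CA g k μ ν z *ᵥ vA g k μ ν z))
    (hu : ∀ g ∈ Window θ.γ, ∀ (k : ℕ) (μ ν : Fin 4) (z : Fin 4 → ℤ) (i : β k),
      |uA g k μ ν z i| ≤ sA * Real.exp (-(κ * ρd k (p k μ ν z) (q k i))))
    (hCA : ∀ g ∈ Window θ.γ, ∀ (k : ℕ) (μ ν : Fin 4) (z : Fin 4 → ℤ) (i i' : β k),
      |CA g k μ ν z i i'| ≤ sC * Real.exp (-(κ * ρd k (q k i) (q k i'))))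
    (hvA : ∀ g ∈ Window θ.γ, ∀ (k : ℕ) (μ ν : Fin 4) (z : Fin 4 → ℤ) (i' : β k),
      |vA g k μ ν z i'| ≤ sB * Real.exp (-(κ * ρd k (q k i') (r k μ ν z))))
    (hV : ∀ (k : ℕ) (s : P k), ∑ i, Real.exp (-(κ / 2 * ρd k s (q k i))) ≤ V)
    (hd : ∀ (k : ℕ) (μ ν : Fin 4) (z : Fin 4 → ℤ), l1 z ≤ ρd k (p k μ ν z) (r k μ ν z)) (μ ν : Fin 4) :
    KernelDecayOfRecord₁₃ F N θ μ ν (κ / 2) := by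
  letI := θ.instVβ₁; letI := θ.instVβ₂; letI := θ.instιβ
  exact kernelDecay_of_threeFactorSizes F _ θ.ρ8 θ.bV ρd hρ0 hρtri q p r uA vA CA hκ hsA hsC hsB hEA hu hCA hvA hV hd μ ν

/-- Monotonicity of the N18 letter of record in `(κ, θ₅, C₅)` (`kernelStepRate_mono` at the record's window). [cite: Balaban1987RG1, Thm 1 p.259 (bookkeeping)] -/
theorem kernelStepRateOfRecord₁₃_mono (θ : Stage13Params F N) {κ κ' θ₅ θ₅' C₅ C₅' : ℝ} (h : KernelStepRateOfRecord₁₃ F N θ κ θ₅ C₅)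
    (hκ : κ' ≤ κ) (hθ0 : 0 ≤ θ₅) (hθ : θ₅ ≤ θ₅') (hC : C₅ ≤ C₅') (hC0 : 0 ≤ C₅') : KernelStepRateOfRecord₁₃ F N θ κ' θ₅' C₅' := by
  letI := θ.instVβ₁; letI := θ.instVβ₂; letI := θ.instιβ
  exact kernelStepRate_mono F θ.ρ8 θ.bV h le_rfl hκ hθ0 hθ hC hC0

/-- The (5.10) class letter of record is antitone in the rate (`kernelDecay_anti`). [cite: Balaban1987RG1, (5.10) p.293 (bookkeeping)] -/
theorem kernelDecayOfRecord₁₃_anti (θ : Stage13Params F N) {μ ν : Fin 4} {κ κ' : ℝ} (h : KernelDecayOfRecord₁₃ F N θ μ ν κ) (hκ : κ' ≤ κ) :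
    KernelDecayOfRecord₁₃ F N θ μ ν κ' := by
  letI := θ.instVβ₁; letI := θ.instVβ₂; letI := θ.instιβ
  exact kernelDecay_anti F θ.ρ8 θ.bV h hκ

variable {N}

/-- ★★★ **UNDER THE v5 PIN, KING's MECHANISM GIVES THE N18 CONJUNCT AT EVERY RUN LENGTH.**  At a Stage-13 tuple with core provisos whose reading has its node-U3 objects
PINNED to the kernel objects of record (`hpin`, = K3⁷ v5 `U3PinnedKernels 𝔯 ℓ'` at the tuple with `ℓ := ℓ' F θ`), the three-factor mechanism on the record's window
with sizes ∕ one-line rates ∕ decay ∕ lattice sums as above, and a letter block DOMINATING the mechanism's letters (`ℓ.κ ≤ κ∕2`, `θ₅ ≤ ℓ.θ₅`, `(cA·sC·sB + sA·cC·sB +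
sA·sC·cB)·V² ≤ ℓ.C₅`, `0 ≤ ℓ.C₅`) give `N18At (rateCarriersOfRecord₁₃CoPH 𝔯 F θ hP g₀ os k).u3` for EVERY `k` — in particular at the selected run length of
`KeyedRatesHolderD4` (dag-n18-w1's `n18At_rateCarriers_of_kernels_pin_of_kernelStepRateOfRecord₁₃`).  NOT N18's discharge: the mechanism's hypotheses ARE the estimate.
[cite: King1986, Prop. 3.9 (3.73) p.665 and (4.42)–(4.43) p.675; Balaban1987RG1, Thm 1 p.259 and (1.20)–(1.22) p.264] -/
theorem n18At_rateCarriers_of_kernels_pin_of_threeFactorRates (𝔯 : RateReading₁₃CoPH N) (θ : Stage13HParams F N)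
    (hP : θ.Provisos₁₃CoPH F N) (g₀ : ℕ → ℝ) (os : List (ULoop F)) (ℓ : U3Letters₁₁)
    (hpin : (𝔯.lit F θ hP g₀ os).u3 = objectsOfRecord₁₃ F N θ.toStage13Params ℓ)
    (ρd : (k : ℕ) → P k → P k → ℝ) (hρ0 : ∀ k p q, 0 ≤ ρd k p q) (hρtri : ∀ k p q r, ρd k p r ≤ ρd k p q + ρd k q r)
    (q : (k : ℕ) → β k → P k) (p r : (k : ℕ) → Fin 4 → Fin 4 → (Fin 4 → ℤ) → P k)
    (uA vA : (ℕ → ℝ) → (k : ℕ) → Fin 4 → Fin 4 → (Fin 4 → ℤ) → β k → ℝ)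
    (CA : (ℕ → ℝ) → (k : ℕ) → Fin 4 → Fin 4 → (Fin 4 → ℤ) → Matrix (β k) (β k) ℝ)
    (uB vB : ℝ → (ℕ → ℝ) → (k : ℕ) → Fin 4 → Fin 4 → (Fin 4 → ℤ) → β k → ℝ)
    (CB : ℝ → (ℕ → ℝ) → (k : ℕ) → Fin 4 → Fin 4 → (Fin 4 → ℤ) → Matrix (β k) (β k) ℝ)
    {κ θ₅ sA sC sB cA cC cB V : ℝ} (hκ : 0 ≤ κ) (hθ : 0 ≤ θ₅) (hsA : 0 ≤ sA) (hsC : 0 ≤ sC) (hsB : 0 ≤ sB)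
    (hcA : 0 ≤ cA) (hcC : 0 ≤ cC) (hcB : 0 ≤ cB)
    (hEA : ∀ g ∈ Window θ.γ, ∀ (k : ℕ) (μ ν : Fin 4) (z : Fin 4 → ℤ),
      (objectsOfRecord₁₃ F N θ.toStage13Params ℓ).EA k g PUnit.unit (pt k μ ν z) =
        uA g k μ ν z ⬝ᵥ (CA g k μ ν z *ᵥ vA g k μ ν z))
    (hEB : ∀ b : ℝ, 0 < b → b ≤ θ.γ → ∀ g ∈ Window θ.γ, ∀ (k : ℕ) (μ ν : Fin 4) (z : Fin 4 → ℤ),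
      (objectsOfRecord₁₃ F N θ.toStage13Params ℓ).EB k b g (bg k μ ν z) (pt k μ ν z) =
        uB b g k μ ν z ⬝ᵥ (CB b g k μ ν z *ᵥ vB b g k μ ν z))
    (hu : ∀ g ∈ Window θ.γ, ∀ (k : ℕ) (μ ν : Fin 4) (z : Fin 4 → ℤ) (i : β k),
      |uA g k μ ν z i| ≤ sA * Real.exp (-(κ * ρd k (p k μ ν z) (q k i))))
    (hCA : ∀ g ∈ Window θ.γ, ∀ (k : ℕ) (μ ν : Fin 4) (z : Fin 4 → ℤ) (i i' : β k),
      |CA g k μ ν z i i'| ≤ sC * Real.exp (-(κ * ρd k (q k i) (q k i'))))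
    (hCB : ∀ b : ℝ, 0 < b → b ≤ θ.γ → ∀ g ∈ Window θ.γ, ∀ (k : ℕ) (μ ν : Fin 4) (z : Fin 4 → ℤ) (i i' : β k),
      |CB b g k μ ν z i i'| ≤ sC * Real.exp (-(κ * ρd k (q k i) (q k i'))))
    (hv : ∀ b : ℝ, 0 < b → b ≤ θ.γ → ∀ g ∈ Window θ.γ, ∀ (k : ℕ) (μ ν : Fin 4) (z : Fin 4 → ℤ) (i' : β k),
      |vB b g k μ ν z i'| ≤ sB * Real.exp (-(κ * ρd k (q k i') (r k μ ν z))))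
    (hdu : ∀ b : ℝ, 0 < b → b ≤ θ.γ → ∀ g ∈ Window θ.γ, ∀ (k : ℕ) (μ ν : Fin 4) (z : Fin 4 → ℤ) (i : β k),
      |uB b g k μ ν z i - uA g k μ ν z i| ≤ cA * θ₅ ^ (k + 1) * Real.exp (-(κ * ρd k (p k μ ν z) (q k i))))
    (hdC : ∀ b : ℝ, 0 < b → b ≤ θ.γ → ∀ g ∈ Window θ.γ, ∀ (k : ℕ) (μ ν : Fin 4) (z : Fin 4 → ℤ) (i i' : β k),
      |CB b g k μ ν z i i' - CA g k μ ν z i i'| ≤ cC * θ₅ ^ (k + 1) * Real.exp (-(κ * ρd k (q k i) (q k i'))))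
    (hdv : ∀ b : ℝ, 0 < b → b ≤ θ.γ → ∀ g ∈ Window θ.γ, ∀ (k : ℕ) (μ ν : Fin 4) (z : Fin 4 → ℤ) (i' : β k),
      |vB b g k μ ν z i' - vA g k μ ν z i'| ≤ cB * θ₅ ^ (k + 1) * Real.exp (-(κ * ρd k (q k i') (r k μ ν z))))
    (hV : ∀ (k : ℕ) (s : P k), ∑ i, Real.exp (-(κ / 2 * ρd k s (q k i))) ≤ V)
    (hd : ∀ (k : ℕ) (μ ν : Fin 4) (z : Fin 4 → ℤ), l1 z ≤ ρd k (p k μ ν z) (r k μ ν z))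
    (hℓκ : ℓ.κ ≤ κ / 2) (hℓθ : θ₅ ≤ ℓ.θ₅) (hℓC : (cA * sC * sB + sA * cC * sB + sA * sC * cB) * V ^ 2 ≤ ℓ.C₅)
    (hℓC0 : 0 ≤ ℓ.C₅) (k : ℕ) :
    N18At (rateCarriersOfRecord₁₃CoPH 𝔯 F θ hP g₀ os k).u3 :=
  n18At_rateCarriers_of_kernels_pin_of_kernelStepRateOfRecord₁₃ F 𝔯 θ hP g₀ os ℓ hpin k
    (kernelStepRateOfRecord₁₃_mono F N θ.toStage13Params
      (kernelStepRateOfRecord₁₃_of_threeFactorRates F N θ.toStage13Params ℓ ρd hρ0 hρtri q p r uA vA CA uB vB CB hκ hθ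
        hsA hsC hsB hcA hcC hcB hEA hEB hu hCA hCB hv hdu hdC hdv hV hd)
      hℓκ hθ hℓθ hℓC hℓC0)

/-- ★★ **UNDER THE v5 PIN, RUN A's SIZES GIVE THE (D4) CONJUNCT AT EVERY RUN LENGTH** (given the letter rows): with `hpin`, the letter block's signs `ℓ.Signs`, `0 < ℓ.κ ≤ κ∕2`
and the read-out row `betaPrime510 4 1 ℓ.κ ≤ ℓ.cr`, run A's three-factor SIZES on the record's window give `ReadOutAt (datumOfRecord₁₃CoPH F N θ hP) (rateCarriersOfRecord₁₃CoPH 𝔯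
F θ hP g₀ os k).u3` for every `k` — the (5.10) clause of record at directions `(0, 1)` comes from the sizes (`kernelDecayOfRecord₁₃_of_threeFactorSizes`, antitone to `ℓ.κ`),
the rest is dag-n27-w1's `readOutAt_objectsOfRecord₁₃_coPH`.  NOT (D4)'s discharge: the sizes of Bałaban's (1.21) kernels ARE (5.10)'s content.
[cite: Balaban1987RG1, (5.10) p.293 and (1.20)–(1.22) p.264; King1986, (4.41) p.675] -/
theorem readOutAt_rateCarriers_of_kernels_pin_of_threeFactorSizes (𝔯 : RateReading₁₃CoPH N) (θ : Stage13HParams F N)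
    (hP : θ.Provisos₁₃CoPH F N) (g₀ : ℕ → ℝ) (os : List (ULoop F)) (ℓ : U3Letters₁₁)
    (hpin : (𝔯.lit F θ hP g₀ os).u3 = objectsOfRecord₁₃ F N θ.toStage13Params ℓ)
    (hs : ℓ.Signs) (hκℓ : 0 < ℓ.κ) (hcr : betaPrime510 4 1 ℓ.κ ≤ ℓ.cr)
    (ρd : (k : ℕ) → P k → P k → ℝ) (hρ0 : ∀ k p q, 0 ≤ ρd k p q) (hρtri : ∀ k p q r, ρd k p r ≤ ρd k p q + ρd k q r)
    (q : (k : ℕ) → β k → P k) (p r : (k : ℕ) → Fin 4 → Fin 4 → (Fin 4 → ℤ) → P k)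
    (uA vA : (ℕ → ℝ) → (k : ℕ) → Fin 4 → Fin 4 → (Fin 4 → ℤ) → β k → ℝ)
    (CA : (ℕ → ℝ) → (k : ℕ) → Fin 4 → Fin 4 → (Fin 4 → ℤ) → Matrix (β k) (β k) ℝ)
    {κ sA sC sB V : ℝ} (hκ : 0 ≤ κ) (hsA : 0 ≤ sA) (hsC : 0 ≤ sC) (hsB : 0 ≤ sB)
    (hEA : ∀ g ∈ Window θ.γ, ∀ (k : ℕ) (μ ν : Fin 4) (z : Fin 4 → ℤ),
      (objectsOfRecord₁₃ F N θ.toStage13Params ℓ).EA k g PUnit.unit (pt k μ ν z) =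
        uA g k μ ν z ⬝ᵥ (CA g k μ ν z *ᵥ vA g k μ ν z))
    (hu : ∀ g ∈ Window θ.γ, ∀ (k : ℕ) (μ ν : Fin 4) (z : Fin 4 → ℤ) (i : β k),
      |uA g k μ ν z i| ≤ sA * Real.exp (-(κ * ρd k (p k μ ν z) (q k i))))
    (hCA : ∀ g ∈ Window θ.γ, ∀ (k : ℕ) (μ ν : Fin 4) (z : Fin 4 → ℤ) (i i' : β k),
      |CA g k μ ν z i i'| ≤ sC * Real.exp (-(κ * ρd k (q k i) (q k i'))))
    (hvA : ∀ g ∈ Window θ.γ, ∀ (k : ℕ) (μ ν : Fin 4) (z : Fin 4 → ℤ) (i' : β k),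
      |vA g k μ ν z i'| ≤ sB * Real.exp (-(κ * ρd k (q k i') (r k μ ν z))))
    (hV : ∀ (k : ℕ) (s : P k), ∑ i, Real.exp (-(κ / 2 * ρd k s (q k i))) ≤ V)
    (hd : ∀ (k : ℕ) (μ ν : Fin 4) (z : Fin 4 → ℤ), l1 z ≤ ρd k (p k μ ν z) (r k μ ν z))
    (hℓκ : ℓ.κ ≤ κ / 2) (k : ℕ) :
    ReadOutAt (datumOfRecord₁₃CoPH F N θ hP) (rateCarriersOfRecord₁₃CoPH 𝔯 F θ hP g₀ os k).u3 := by
  show ReadOutAt (datumOfRecord₁₃CoPH F N θ hP) (u3OfRecord₁₃ θ.toStage13Params (𝔯.lit F θ hP g₀ os).u3 k)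
  rw [hpin]
  exact readOutAt_objectsOfRecord₁₃_coPH θ hP ℓ hs hκℓ hcr k
    (kernelDecayOfRecord₁₃_anti F N θ.toStage13Params
      (kernelDecayOfRecord₁₃_of_threeFactorSizes F N θ.toStage13Params ℓ ρd hρ0 hρtri q p r uA vA CA hκ hsA hsC hsB
        hEA hu hCA hvA hV hd 0 1) hℓκ)

end Record

end YMDAG.N18.KernelStepRateKingMechanism

end
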